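import Summits.NavierStokesRegularity.NavierStokesRegularity.Theorems.TypeILiouvilleTypeIliouvilleNoTypeIIEternalEnergyCesaro
import Literature.Analysis.FluidPDE.KNSSOseenMildDecayTools
import HarnessLib

/-!
# EEL′ reduces to profiles attaining their space–time supremum at the origin (crux
# `TypeIliouvilleNoTypeII`, stmt-NavierStokesRegularity-0056; rigidity residual EEL′ of the
# pressure-free eternal split)

Helper file (theorems only).  The pressure-free eternal energy Liouville statement EEL′ — the
`hEEL` binder of `EternalSplit.typeIliouvilleNoTypeII_of_pressureFreeSlab_of_eternalLiouville`: a
bounded eternal Oseen-mild smooth divergence-free `v`, `‖v‖ ≤ 2`, whose Albritton–Barker quantities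
`A`, `C`, `E` are bounded by a finite `I` on ALL parabolic balls, has `v(0,0) = 0` — is OPEN.  This
file proves the control-lens rider R3 (`SupAttainedReduction`, HOME
`ns-plan-lens-control-typeII/EELRiders.lean`): **it suffices to prove EEL′ for profiles that attain
their GLOBAL space–time supremum modulus at the origin**, `‖v(s, y)‖ ≤ ‖v(0, 0)‖` for all `(s, y)`.

Mechanism (`eternalLiouvillePressureFree_of_supAttained`): if `v(0,0) ≠ 0`, let
`M = sup ‖v‖ ∈ (0, 2]` and pick `(s_k, y_k)` with `‖v(s_k, y_k)‖ → M`.  The translates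
`w_k(s, y) = v(s + s_k, y + y_k)` are again bounded eternal Oseen-mild smooth divergence-free fields
(`heatExtension_comp_add_right`, `oseenDuhamel_translate`, `oseenDuhamel_comp_add_right`) with the
SAME bound `I` on `A`, `C`, `E` over all balls (translation invariance, the case `c = 1` of
`cknAEss_nsZoom` / `cknC_nsZoom` / `cknE_nsZoom`).  The `C¹_loc` compactness of bounded Oseen-mild
fields (`ImmortalZoom.exists_tendsto_of_bounded_seq`, KNSS 2009 Prop. 4.1 / Lemma 6.1) extracts a
limit `W` with `w_{φ(j)} → W` and `∇w_{φ(j)} → ∇W` pointwise; `‖W‖ ≤ M = ‖W(0,0)‖`, and `A, C, E ≤ I`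
pass to `W` by the lower-semicontinuity lemmas `EternalSplit.cknAEss_le_of_tendsto` /
`cknC_le_of_tendsto` / `cknE_le_of_tendsto` (p455305).  The sup-attained case gives `W(0,0) = 0`,
i.e. `M = 0` — contradiction.

* `contDiff_translate`, `isDivFree_translate`, `mild_translate`, `cknAEss_translate`,
  `cknC_translate`, `cknE_translate` — the translates of an eternal profile;
* `eternalLiouvillePressureFree_of_supAttained` — **R3: EEL′ ⟸ EEL′ for sup-attained profiles**,
  both sides in the exact `hEEL` hypothesis shape (the sup-attained side with `‖v‖ ≤ ‖v(0,0)‖` in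
  place of `‖v‖ ≤ 2`).

Normal form at such a maximum (not used here): `∂ₛ|v|² = 0`, `∇|v|² = 0`, `Δ|v|² ≤ 0` at `(0,0)`.
WHAT THIS IS NOT: not NS; EEL′ and its sup-attained form both stay OPEN — this is a reduction.
-/

noncomputable section

-- the summit and its single problem share the name `NavierStokesRegularity` (D-0017 nested layout)
set_option linter.dupNamespace false

open Set Function Filter Topology MeasureTheory Metric
open scoped NNReal ENNReal

namespace Summit.NavierStokesRegularity.NavierStokesRegularity.Theorems.TypeIliouvilleNoTypeII.TypeIIZoom

open Literature.Analysis Literature.Analysis.FluidPDE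
open Summit.NavierStokesRegularity.NavierStokesRegularity.Theorems.TypeIliouvilleNoTypeII.ImmortalZoom
  (exists_tendsto_of_bounded_seq)
open Summit.NavierStokesRegularity.NavierStokesRegularity.Theorems.TypeIliouvilleNoTypeII.EternalSplit
  (cknAEss_le_of_tendsto cknC_le_of_tendsto cknE_le_of_tendsto)

variable {v : ℝ → EuclideanSpace ℝ (Fin 3) → EuclideanSpace ℝ (Fin 3)}

/-! ## Translates of an eternal profile -/

/-- The space–time translate `(s, y) ↦ v(s + c, y + a)` of a jointly smooth field is jointly
smooth. [folklore] -/
theorem contDiff_translate (hv : ContDiff ℝ (⊤ : ℕ∞) (uncurry v)) (c : ℝ)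
    (a : EuclideanSpace ℝ (Fin 3)) :
    ContDiff ℝ (⊤ : ℕ∞) (uncurry fun s y => v (s + c) (y + a)) :=
  hv.comp ((contDiff_fst.add contDiff_const).prodMk (contDiff_snd.add contDiff_const))

/-- The translate of a divergence-free slice is divergence free. [folklore] -/
theorem isDivFree_translate (hdiv : ∀ t, VectorCalculus.IsDivFree (v t)) (c : ℝ)
    (a : EuclideanSpace ℝ (Fin 3)) (t : ℝ) :
    VectorCalculus.IsDivFree ((fun s y => v (s + c) (y + a)) t) :=
  (hdiv (t + c)).comp_add_right a

/-- **The translate of an eternal Oseen-mild field is eternal Oseen-mild**: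
`w(t) = e^{(t-s)Δ} w(s) - B¹_s(w, w)(t)` for `w(s, y) = v(s + c, y + a)` (the heat flow and the
Oseen term commute with space translations and time shifts: `heatExtension_comp_add_right`,
`oseenDuhamel_comp_add_right`, `oseenDuhamel_translate`). [folklore] -/
theorem mild_translate
    (hmild : ∀ s t : ℝ, s < t → ∀ x, v t x = heatFlow (v s) (t - s) x - oseenDuhamel 1 s v v t x)
    (c : ℝ) (a : EuclideanSpace ℝ (Fin 3)) (s t : ℝ) (hst : s < t) (x : EuclideanSpace ℝ (Fin 3)) :
    (fun s y => v (s + c) (y + a)) t x =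
      heatFlow ((fun s y => v (s + c) (y + a)) s) (t - s) x -
        oseenDuhamel 1 s (fun s y => v (s + c) (y + a)) (fun s y => v (s + c) (y + a)) t x := by
  have h := hmild (s + c) (t + c) (by linarith) (x + a)
  have hts : t + c - (s + c) = t - s := by ring
  rw [hts] at h
  have e1 : heatFlow ((fun s y => v (s + c) (y + a)) s) (t - s) x =
      heatFlow (v (s + c)) (t - s) (x + a) := by
    simp only [heatFlow_of_pos _ (sub_pos.2 hst)]
    exact heatExtension_comp_add_right (v (s + c)) a (t - s) x
  have e2 : oseenDuhamel 1 s (fun s y => v (s + c) (y + a)) (fun s y => v (s + c) (y + a)) t x =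
      oseenDuhamel 1 (s + c) v v (t + c) (x + a) := by
    rw [← oseenDuhamel_comp_add_right 1 (s + c) v v a (t + c) x,
      ← oseenDuhamel_translate 1 s c (fun τ y => v τ (y + a)) (fun τ y => v τ (y + a)) t x]
  rw [e1, e2]
  exact h

/-- The translate as a unit-scale pull-back: `w = 1 • stPull 1 1 c a v`. [folklore] -/
theorem translate_eq_stPull (c : ℝ) (a : EuclideanSpace ℝ (Fin 3)) :
    (fun s y => v (s + c) (y + a)) = (1 : ℝ) • stPull ((1 : ℝ) ^ 2) 1 c a v := by
  funext s y
  simp only [Pi.smul_apply, stPull_apply, one_pow, one_mul, one_smul, add_comm]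

/-- The gradient of the translate is the translate of the gradient, as a unit-scale pull-back.
[folklore] -/
theorem fderiv_translate_eq_stPull (c : ℝ) (a : EuclideanSpace ℝ (Fin 3)) :
    (fun s y => fderiv ℝ ((fun s y => v (s + c) (y + a)) s) y) =
      (1 : ℝ) ^ 2 • stPull ((1 : ℝ) ^ 2) 1 c a (fun s y => fderiv ℝ (v s) y) := by
  funext s y
  simp only [Pi.smul_apply, stPull_apply, one_pow, one_mul, one_smul]
  rw [fderiv_comp_add_right, add_comm s c, add_comm y a]

/-- **Translation invariance of `A_ess`** over all balls: `A_ess(w; Q(z, r)) = A_ess(v; Q(z + (c, a), r))`.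
[folklore] -/
theorem cknAEss_translate {r : ℝ} (hr : 0 < r) (c : ℝ) (a : EuclideanSpace ℝ (Fin 3))
    (z : ℝ × EuclideanSpace ℝ (Fin 3)) :
    cknAEss r z (fun s y => v (s + c) (y + a)) = cknAEss r (stAffine ((1 : ℝ) ^ 2) 1 c a z) v := by
  rw [translate_eq_stPull, cknAEss_nsZoom one_pos hr, one_mul]

/-- **Translation invariance of `C`** over all balls. [folklore] -/
theorem cknC_translate {r : ℝ} (hr : 0 < r) (c : ℝ) (a : EuclideanSpace ℝ (Fin 3))
    (z : ℝ × EuclideanSpace ℝ (Fin 3)) :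
    cknC r z (fun s y => v (s + c) (y + a)) = cknC r (stAffine ((1 : ℝ) ^ 2) 1 c a z) v := by
  rw [translate_eq_stPull, cknC_nsZoom one_pos hr, one_mul]

/-- **Translation invariance of `E`** over all balls. [folklore] -/
theorem cknE_translate {r : ℝ} (hr : 0 < r) (c : ℝ) (a : EuclideanSpace ℝ (Fin 3))
    (z : ℝ × EuclideanSpace ℝ (Fin 3)) :
    cknE r z (fun s y => fderiv ℝ ((fun s y => v (s + c) (y + a)) s) y) =
      cknE r (stAffine ((1 : ℝ) ^ 2) 1 c a z) (fun s y => fderiv ℝ (v s) y) := by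
  rw [fderiv_translate_eq_stPull, cknE_nsZoom one_pos hr, one_mul]

/-! ## R3 — the sup-attained reduction -/

/-- **R3: EEL′ follows from EEL′ for sup-attained profiles.**  Suppose every jointly smooth,
divergence-free, eternal Oseen-mild field `W` on `ℝ × ℝ³` with `‖W(s, y)‖ ≤ ‖W(0, 0)‖` everywhere
and `A_ess, C, E ≤ I` (some `I ≠ ∞`) on all parabolic balls has `W(0, 0) = 0`.  Then EEL′ holds:
every such field with `‖v‖ ≤ 2` in place of the sup-attained hypothesis has `v(0, 0) = 0`.
Proof: translate along a sup-approximating sequence, extract a `C¹_loc` limit by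
`ImmortalZoom.exists_tendsto_of_bounded_seq`, pass `A, C, E ≤ I` to the limit by
`EternalSplit.cknAEss_le_of_tendsto` / `cknC_le_of_tendsto` / `cknE_le_of_tendsto`; the limit
attains `sup ‖v‖` at the origin, so it vanishes there, forcing `sup ‖v‖ = 0`. [cite: KochNadirashviliSereginSverak2009, Lemma 6.1 and Prop. 4.1 (arXiv:0709.3599 pp. 8, 11)] -/
theorem eternalLiouvillePressureFree_of_supAttained
    (hSA : ∀ W : ℝ → EuclideanSpace ℝ (Fin 3) → EuclideanSpace ℝ (Fin 3),
      ContDiff ℝ (⊤ : ℕ∞) (uncurry W) → (∀ t, VectorCalculus.IsDivFree (W t)) →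
      (∀ s t : ℝ, s < t → ∀ x, W t x = heatFlow (W s) (t - s) x - oseenDuhamel 1 s W W t x) →
      (∀ t x, ‖W t x‖ ≤ ‖W 0 0‖) →
      (∃ I : ℝ≥0∞, I ≠ ⊤ ∧ ∀ r : ℝ, 0 < r → ∀ z : ℝ × EuclideanSpace ℝ (Fin 3),
        cknAEss r z W ≤ I ∧ cknC r z W ≤ I ∧ cknE r z (fun s y => fderiv ℝ (W s) y) ≤ I) →
      W 0 0 = 0)
    (v : ℝ → EuclideanSpace ℝ (Fin 3) → EuclideanSpace ℝ (Fin 3))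
    (hv : ContDiff ℝ (⊤ : ℕ∞) (uncurry v)) (hdiv : ∀ t, VectorCalculus.IsDivFree (v t))
    (hmild : ∀ s t : ℝ, s < t → ∀ x, v t x = heatFlow (v s) (t - s) x - oseenDuhamel 1 s v v t x)
    (hbd : ∀ (t : ℝ) (x : EuclideanSpace ℝ (Fin 3)), ‖v t x‖ ≤ 2)
    (hI : ∃ I : ℝ≥0∞, I ≠ ⊤ ∧ ∀ r : ℝ, 0 < r → ∀ z : ℝ × EuclideanSpace ℝ (Fin 3),
      cknAEss r z v ≤ I ∧ cknC r z v ≤ I ∧ cknE r z (fun s y => fderiv ℝ (v s) y) ≤ I) :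
    v 0 0 = 0 := by
  obtain ⟨I, hItop, hball⟩ := hI
  by_contra h0
  -- ## the supremum `M ∈ (0, 2]`
  obtain ⟨M, hM⟩ : ∃ M : ℝ, M = ⨆ q : ℝ × EuclideanSpace ℝ (Fin 3), ‖v q.1 q.2‖ := ⟨_, rfl⟩
  have hbdd : BddAbove (range fun q : ℝ × EuclideanSpace ℝ (Fin 3) => ‖v q.1 q.2‖) :=
    ⟨2, by rintro _ ⟨q, rfl⟩; exact hbd q.1 q.2⟩
  have hleM : ∀ (t : ℝ) (x : EuclideanSpace ℝ (Fin 3)), ‖v t x‖ ≤ M := fun t x => by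
    rw [hM]; exact le_ciSup hbdd (t, x)
  have hMpos : 0 < M := lt_of_lt_of_le (norm_pos_iff.2 h0) (hleM 0 0)
  -- ## a sup-approximating sequence
  have hseq : ∀ k : ℕ, ∃ q : ℝ × EuclideanSpace ℝ (Fin 3), M - 1 / ((k : ℝ) + 1) < ‖v q.1 q.2‖ := by
    intro k
    have hlt : M - 1 / ((k : ℝ) + 1) < ⨆ q : ℝ × EuclideanSpace ℝ (Fin 3), ‖v q.1 q.2‖ := by
      rw [← hM]
      have h1 : (0 : ℝ) < 1 / ((k : ℝ) + 1) := by positivity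
      linarith
    exact exists_lt_of_lt_ciSup hlt
  choose q hq using hseq
  -- ## the translates
  set w : ℕ → ℝ → EuclideanSpace ℝ (Fin 3) → EuclideanSpace ℝ (Fin 3) :=
    fun k s y => v (s + (q k).1) (y + (q k).2) with hw
  have hwc : ∀ k, ContDiff ℝ (⊤ : ℕ∞) (uncurry (w k)) := fun k => contDiff_translate hv _ _
  have hwdiv : ∀ k t, VectorCalculus.IsDivFree (w k t) := fun k t => isDivFree_translate hdiv _ _ t
  have hwdivw : ∀ k t, IsWeaklyDivFree (w k t) := fun k t =>
    VectorCalculus.IsDivFree.isWeaklyDivFree_holds (hwdiv k t)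
      (((hwc k).comp (contDiff_prodMk_right t)).of_le (by simp))
  have hwmild : ∀ k (s t : ℝ), s < t → ∀ x,
      w k t x = heatFlow (w k s) (t - s) x - oseenDuhamel 1 s (w k) (w k) t x :=
    fun k s t hst x => mild_translate hmild _ _ s t hst x
  have hwbd : ∀ k t x, ‖w k t x‖ ≤ 2 := fun k t x => hbd _ _
  have hwM : ∀ k t x, ‖w k t x‖ ≤ M := fun k t x => hleM _ _
  have hwA : ∀ k (r : ℝ), 0 < r → ∀ z : ℝ × EuclideanSpace ℝ (Fin 3), cknAEss r z (w k) ≤ I :=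
    fun k r hr z => by rw [hw, cknAEss_translate hr]; exact (hball r hr _).1
  have hwC : ∀ k (r : ℝ), 0 < r → ∀ z : ℝ × EuclideanSpace ℝ (Fin 3), cknC r z (w k) ≤ I :=
    fun k r hr z => by rw [hw, cknC_translate hr]; exact (hball r hr _).2.1
  have hwE : ∀ k (r : ℝ), 0 < r → ∀ z : ℝ × EuclideanSpace ℝ (Fin 3),
      cknE r z (fun s y => fderiv ℝ (w k s) y) ≤ I :=
    fun k r hr z => by rw [hw, cknE_translate hr]; exact (hball r hr _).2.2
  -- ## compactness
  have hB : Tendsto (fun k : ℕ => (k : ℝ) + 1) atTop atTop :=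
    tendsto_natCast_atTop_atTop.atTop_add tendsto_const_nhds
  have hA : Tendsto (fun k : ℕ => -((k : ℝ) + 1)) atTop atBot := tendsto_neg_atTop_atBot.comp hB
  obtain ⟨φ, hφ, W, hW, hWdiv, hWmild, -, hWlim, hWglim⟩ :=
    exists_tendsto_of_bounded_seq 2 hA hB (w := w)
      (fun k => (hwc k).continuous.continuousOn) (fun k t _ => hwdivw k t)
      (fun k s t _ hst _ x => by
        rw [← heatFlow_of_pos _ (sub_pos.2 hst)]
        exact hwmild k s t hst x)
      (fun k t _ x => hwbd k t x)
  -- ## the limit attains `M` at the origin and is bounded by `M`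
  have hWle : ∀ t x, ‖W t x‖ ≤ M := fun t x =>
    le_of_tendsto' (hWlim t x).norm fun j => hwM _ _ _
  have hW00 : ‖W 0 0‖ = M := by
    have h1 : Tendsto (fun j => ‖w (φ j) 0 0‖) atTop (𝓝 M) := by
      have hlow : Tendsto (fun j => M - 1 / (((φ j : ℕ) : ℝ) + 1)) atTop (𝓝 M) := by
        have h := tendsto_const_nhds.sub
          (tendsto_one_div_add_atTop_nhds_zero_nat.comp hφ.tendsto_atTop) (a := M)
        simpa using h
      refine tendsto_of_tendsto_of_tendsto_of_le_of_le hlow tendsto_const_nhds (fun j => ?_)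
        (fun j => hwM _ _ _)
      have h := hq (φ j)
      simp only [hw, zero_add]
      exact h.le
    exact tendsto_nhds_unique (hWlim 0 0).norm h1
  -- ## `A, C, E ≤ I` pass to the limit
  have hWI : ∀ r : ℝ, 0 < r → ∀ z : ℝ × EuclideanSpace ℝ (Fin 3),
      cknAEss r z W ≤ I ∧ cknC r z W ≤ I ∧ cknE r z (fun s y => fderiv ℝ (W s) y) ≤ I := by
    intro r hr z
    refine ⟨?_, ?_, ?_⟩
    · exact cknAEss_le_of_tendsto (w := fun j => w (φ j)) (N := 2) hr
        (Eventually.of_forall fun j => (hwc (φ j)).continuous.continuousOn)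
        (Eventually.of_forall fun j p _ => hwbd (φ j) p.1 p.2)
        (fun p _ => hWlim p.1 p.2) (Eventually.of_forall fun j => hwA (φ j) r hr z)
    · exact cknC_le_of_tendsto (w := fun j => w (φ j)) (N := 2) hr
        (Eventually.of_forall fun j => (hwc (φ j)).continuous.continuousOn)
        (Eventually.of_forall fun j p _ => hwbd (φ j) p.1 p.2)
        (fun p _ => hWlim p.1 p.2) (Eventually.of_forall fun j => hwC (φ j) r hr z)
    · exact cknE_le_of_tendsto (w := fun j => w (φ j)) hr
        (Eventually.of_forall fun j => (continuous_fderiv_slice (hwc (φ j))).continuousOn)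
        (fun p _ => hWglim p.1 p.2) (Eventually.of_forall fun j => hwE (φ j) r hr z)
  -- ## the sup-attained case kills the limit
  have hzero := hSA W hW hWdiv hWmild (fun t x => by rw [hW00]; exact hWle t x) ⟨I, hItop, hWI⟩
  rw [hzero, norm_zero] at hW00
  exact hMpos.ne' hW00.symm

end Summit.NavierStokesRegularity.NavierStokesRegularity.Theorems.TypeIliouvilleNoTypeII.TypeIIZoom

end
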